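import Summits.BirchSwinnertonDyer.BirchSwinnertonDyer.Theses.PrintX6
import Summits.BirchSwinnertonDyer.BirchSwinnertonDyer.Theorems.PrintX6DescentCertificateRoad
import Summits.BirchSwinnertonDyer.Rank1Residual.Supersingular.KobayashiMainConjecture
import Literature.NumberTheory.EllipticCurves.PlusMinusPAdicLFunctionProofs
import HarnessLib

/-!
# Route `PrintX6`, crux `EisensteinHalfFiveLe` (stmt-BirchSwinnertonDyer-20276) / residual `EisensteinHalfAtThree`
# (stmt-20285): the DESCENT stub of the birth skeleton MODULO the route's published inputs, and the two cruxes from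
# their signed-divisibility stubs (cell `bsd-print-x6`, seat p4; a `--supports … --as helper` file, closes nothing)

PARTITION currency (D-0054): leaf A6 = X6 ∧ r_an = 0 (`WAllCornerX6r0`); class-wide statements MODULO the route's
input conjunction `PublishedInputsX6` (nine REFEREED named facts, by name) and the OPEN one-sign Eisenstein divisibility
`Supersingular.KobayashiLowerDivisibility` (= K3 crux `KobayashiLowerHalfSemistable`, stmt-19000, by name). BEYOND-PRINT
THEOREM: **NO**. Nothing is booked; nothing here is new mathematics (the descent is the tree theorem
`Supersingular.missingLowerBoundAt_of_kobayashiLowerDivisibility`, b2b-bsdres, rewired to the route's ∀q / non-unit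
value-cell form).

What this file proves:
* `signedDescentRankZero_of_inputs : PublishedInputsX6 → <stub_signedDescentRankZero verbatim>` — the birth skeleton's
  stub 2 (registered on 20276, sha 86d96c66…) MODULO the inputs. NOTE TO THE PLANNER: the stub AS REGISTERED carries no
  `PublishedInputsX6 →` prefix and is therefore NOT provable in the tree (it consumes Kobayashi 2003 Thm 1.2, B. D. Kim
  2013 Cor 3.15, modularity and GZK — conjuncts 1, 3, 7, 8, 9 of `PublishedInputsX6`, none of which has a `_holds`
  theorem; Pollack's ± `p`-adic `L`-function is the tree THEOREM `pollack_exists_plusMinusPAdicLFunction_holds`);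
  re-registering it with the prefix makes this theorem the verbatim closer.
* `eisensteinHalfFiveLe_of_inputs_of_signedLowerDivisibilityFiveLe` — crux 2 BY NAME from the inputs and the birth
  skeleton's stub 1 (`stub_signedLowerDivisibilityFiveLe`, = the p ≥ 5 part of K3's stmt-19000 with `¬CM`, `r_an = 0`
  added); `eisensteinHalfAtThree_of_inputs_of_signedLowerDivisibilityAtThree` — the p = 3 twin for the residual crux 3.
* `eisensteinHalf_cell_of_card_selmerGroup_primePow` — the PER-PAIR discharge of either crux's conclusion at one cell
  from ONE explicit descent certificate (`#Sel^(p^k)(E/ℚ) = p^m`, `ord_p #Ш_an ≤ m`) and GZK only (seat p4's road,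
  `PrintX6.X6.missingLowerBoundAt_rankZero_of_card_selmerGroup_primePow`): what closes the cruxes cell by cell while the
  class-wide statement waits for print.

References: Kobayashi 2003 Thm 1.2, (3.6) [Kobayashi2003]; B. D. Kim 2013 Cor 3.15 [BDKim2013]; Pollack 2003 Prop 6.18
[Pollack2003]; Miller 2011 Def 1.1 [Miller2011LMS]; Silverman AEC X.4.2 [SilvermanAEC2009]; HOME/PLAN.md v1 (p4 (ii)).
-/

set_option autoImplicit false
set_option linter.dupNamespace false

noncomputable section

open scoped Classical

open WeierstrassCurve Literature.NumberTheory.EllipticCurves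
  Literature.NumberTheory.EllipticCurves.Rank1Residual
  Literature.NumberTheory.EllipticCurves.Rank1Residual.Typed
  Summit.BirchSwinnertonDyer.Rank1Residual.Supersingular
  Summit.BirchSwinnertonDyer.BirchSwinnertonDyer.Theses.PrintX6

namespace Summit.BirchSwinnertonDyer.BirchSwinnertonDyer.Theorems.PrintX6

/-- **Birth-skeleton stub 2 (`stub_signedDescentRankZero`, verbatim body) MODULO `PublishedInputsX6`.** For every
X6 pair with odd `p` and `ord_{s=1} L(E,s) = 0`: the Eisenstein divisibility `KobayashiLowerDivisibility W p ε` for ONE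
sign forces, for every rational `q` with `#Ш(E)_an = q` (and `ord_p q ≠ 0`, unused: the unit cells need no lower
half), `ord_p q ≤ ord_p #Ш(E/ℚ)`. The tree's `missingLowerBoundAt_of_kobayashiLowerDivisibility` (Kobayashi Thm 1.2
`h12`, Kim Cor 3.15 `hKim`, Pollack — a tree THEOREM —, modularity `hmodP`, GZK `hGZK`; `a_p = 0` and `E[p]`
irreducible automatic on X6, `L(E,1) ≠ 0` from `r_an = 0` by `hmod`) in the route's ∀q form (the witness of
`MissingLowerBoundAt` is THE `q`, `shaAn W = q` being injective in `q`). CONDITIONAL on the inputs only.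
[cite: Kobayashi2003, Thm. 1.2 and (3.6)] [cite: BDKim2013, Cor. 3.15 (p. 199)] [cite: Pollack2003, Prop. 6.18]
[cite: Miller2011LMS, Def. 1.1] -/
theorem signedDescentRankZero_of_inputs (hPub : PublishedInputsX6) :
    ∀ (W : WeierstrassCurve ℚ) [W.IsElliptic] [W.IsGloballyMinimal] (p : ℕ) [Fact p.Prime],
      p ≠ 2 → Literature.NumberTheory.EllipticCurves.Rank1Residual.ClassX6 W p → W.analyticRank = 0 →
      (∃ ε : ℤˣ, Summit.BirchSwinnertonDyer.Rank1Residual.Supersingular.KobayashiLowerDivisibility W p ε) →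
      ∀ q : ℚ, Literature.NumberTheory.EllipticCurves.shaAn W = (q : ℂ) → padicValRat p q ≠ 0 →
        padicValRat p q ≤ (padicValNat p W.shaOrder : ℤ) := by
  obtain ⟨h12, -, hKim, -, -, -, hmodP, hmod, hGZK⟩ := hPub
  intro W _ _ p _ hp hX hr hε q hq _
  obtain ⟨ε, hdiv⟩ := hε
  have hL : W.entireLFunction 1 ≠ 0 := (W.analyticRank_eq_zero_iff_holds (hmod W)).1 hr
  obtain ⟨q', hq', hle⟩ := missingLowerBoundAt_of_kobayashiLowerDivisibility W p h12 hKim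
    pollack_exists_plusMinusPAdicLFunction_holds hmodP hGZK hp hX.1.1
    (ClassX6.frobeniusTrace_eq_zero W p hp hX) (ClassX6.irr W p hp hX) hL hdiv
  have hqq : q' = q := by exact_mod_cast hq'.symm.trans hq
  subst hqq
  exact hle

/-- **Crux 2 `EisensteinHalfFiveLe` BY NAME from the inputs and the birth skeleton's stub 1** (the signed lower
divisibility on X6 ∧ ¬CM ∧ r_an = 0 at `p ≥ 5` for one sign — the value-level shadow of K3's stmt-19000):
`PublishedInputsX6 → stub_signedLowerDivisibilityFiveLe → EisensteinHalfFiveLe`, by `signedDescentRankZero_of_inputs`.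
CONDITIONAL on both hypotheses; the crux stays OPEN. [cite: Kobayashi2003, Thm. 1.2 and (3.6)]
[cite: BDKim2013, Cor. 3.15 (p. 199)] [cite: Miller2011LMS, Def. 1.1] -/
theorem eisensteinHalfFiveLe_of_inputs_of_signedLowerDivisibilityFiveLe (hPub : PublishedInputsX6)
    (hdiv : ∀ (W : WeierstrassCurve ℚ) [W.IsElliptic] [W.IsGloballyMinimal] (p : ℕ) [Fact p.Prime],
      ¬ W.HasCM → 5 ≤ p → Literature.NumberTheory.EllipticCurves.Rank1Residual.ClassX6 W p →
      W.analyticRank = 0 →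
      ∃ ε : ℤˣ, Summit.BirchSwinnertonDyer.Rank1Residual.Supersingular.KobayashiLowerDivisibility W p ε) :
    EisensteinHalfFiveLe := by
  intro W _ _ p _ hcm hp5 hX hr q hq hv
  exact signedDescentRankZero_of_inputs hPub W p (by omega) hX hr (hdiv W p hcm hp5 hX hr) q hq hv

/-- **Residual crux 3 `EisensteinHalfAtThree` BY NAME from the inputs and a signed lower divisibility at `p = 3`**
(one sign, X6 ∧ ¬CM ∧ r_an = 0 at `3`, `a₃ = 0`): the p = 3 twin. CONDITIONAL; the crux stays OPEN (its divisibility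
rests on BSTW's p = 3 tier ⊃ [SV-S-Ohta], unpublished). [cite: Kobayashi2003, Thm. 1.2 and (3.6)]
[cite: BDKim2013, Cor. 3.15 (p. 199)] [cite: Miller2011LMS, Def. 1.1] -/
theorem eisensteinHalfAtThree_of_inputs_of_signedLowerDivisibilityAtThree (hPub : PublishedInputsX6)
    (hdiv : ∀ (W : WeierstrassCurve ℚ) [W.IsElliptic] [W.IsGloballyMinimal] (p : ℕ) [Fact p.Prime],
      ¬ W.HasCM → p = 3 → Literature.NumberTheory.EllipticCurves.Rank1Residual.ClassX6 W p →
      W.analyticRank = 0 →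
      ∃ ε : ℤˣ, Summit.BirchSwinnertonDyer.Rank1Residual.Supersingular.KobayashiLowerDivisibility W p ε) :
    EisensteinHalfAtThree := by
  intro W _ _ p _ hcm hp3 hX hr q hq hv
  exact signedDescentRankZero_of_inputs hPub W p (by omega) hX hr (hdiv W p hcm hp3 hX hr) q hq hv

/-- **The cruxes' conclusion AT ONE CELL from ONE explicit descent certificate (seat p4's road).** For an X6 pair
with odd `p`, `ord_{s=1} L(E,s) = 0`, `#Ш(E)_an = q`, and an exact `p^k`-descent `#Sel^(p^k)(E/ℚ) = p^m` with
`ord_p q ≤ m`: `ord_p q ≤ ord_p #Ш(E/ℚ)` — the common conclusion of `EisensteinHalfFiveLe` / `EisensteinHalfAtThree`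
at that cell, from GZK ALONE among the inputs (`PrintX6.X6.missingLowerBoundAt_rankZero_of_card_selmerGroup_primePow`:
`Sel^(p^k) ≅ Ш[p^k]` by Silverman X.4.2, `E(ℚ)[p] = 0` by `ClassX6.irr`). Per pair; the class-wide cruxes are
untouched. [cite: SilvermanAEC2009, Thm X.4.2(a)] [cite: Miller2011LMS, Def. 1.1 (arXiv:1010.2431 p. 3)] -/
theorem eisensteinHalf_cell_of_card_selmerGroup_primePow
    (hGZK : rank_eq_analyticRank_of_analyticRank_le_one)
    (W : WeierstrassCurve ℚ) [W.IsElliptic] [W.IsGloballyMinimal] (p : ℕ) [Fact p.Prime]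
    (hp2 : p ≠ 2) (hX : ClassX6 W p) (hr : W.analyticRank = 0) {k m : ℕ}
    (hcard : Nat.card (W.selmerGroup ((p ^ k : ℕ) : ℤ)) = p ^ m)
    {q : ℚ} (hq : shaAn W = (q : ℂ)) (hv : padicValRat p q ≤ m) :
    padicValRat p q ≤ (padicValNat p W.shaOrder : ℤ) := by
  obtain ⟨q', hq', hle⟩ :=
    X6.missingLowerBoundAt_rankZero_of_card_selmerGroup_primePow W p hGZK hp2 hX hr hcard hq hv
  have hqq : q' = q := by exact_mod_cast hq'.symm.trans hq
  subst hqq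
  exact hle

end Summit.BirchSwinnertonDyer.BirchSwinnertonDyer.Theorems.PrintX6

end
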